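import Literature.Geometry.Lorentzian.NullScreenAlgebra
import HarnessLib

/-!
# Null rigidity of a dominated skew/symmetric pair at a null vector of a Lorentzian scalar product

Pointwise linear algebra behind the "evanescent light point" theorem of the stationary black-hole
programme (a local maximum of `g(T,T)` of a Killing field `T` at a point where `T` is null forces,
in vacuum, `∇T` to be a null bivector and `T` to be a repeated principal null direction): the
manifold-level statement lives in
`Summits/FinalStateConjecture/FinalStateConjecture/Theorems/ZeroEnergyKerrOrBombErgoregionBombModTEvanescentSpecial.lean`;
here only the scalar-product algebra, in the setting and vocabulary of `NullScreenAlgebra.lean`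
(a symmetric bilinear form `B` on a finite-dimensional real normed space `V` which is Lorentzian in
the sense of `LorentzianMetric` — a timelike `T`, `B` positive definite on timelike
orthocomplements — and a null vector `ℓ` with an orthonormal screen frame).

* `null_rigidity_of_dominated`: for a `B`-skew `A` with `A ℓ = 0` and an endomorphism `F` with
  `F ℓ = 0`, `B(F u, ℓ) = 0`, `B(F u, w) = B(F w, u)`, `tr F = 0` and `B(A v, A v) ≤ B(F v, v)`:
  `F` kills `ℓ^⊥`, `F = μ B(ℓ, ·) ℓ` with `μ ≥ 0`, and `A = ℓ ∧ β` for some `β ⊥ ℓ`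
  (the algebra of `Ψ₀ = Ψ₁ = 0` plus vanishing expansion/shear/twist of a non-expanding null
  structure, Ashtekar–Beetle–Lewandowski 2002, §2; Hawking–Ellis 1973, §4.2);
* `trace_comp_self_eq_zero_of_eq_wedge`: for `A = ℓ ∧ β` with `β ⊥ ℓ`, `B(A v, A v) =
  B(ℓ, v)² B(β, β)` and `tr(A ∘ A) = 0` (`LinearMap.trace_smulRight`);
* `exists_eq_wedge_of_skew_of_screen_sq_eq_zero` (appended): conversely a `B`-skew `A` with
  `A ℓ = 0` and `B(A eᵢ, A eᵢ) = 0` on a screen frame is `ℓ ∧ β` for some `β ⊥ ℓ`.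

Everything is proved; no definitions, no named facts.

## References

* B. O'Neill, *Semi-Riemannian geometry with applications to relativity* (1983), Ch. 5,
  Lemma 5.26–5.28.
* S. W. Hawking, G. F. R. Ellis, *The large scale structure of space-time* (1973), §4.2.
* A. Ashtekar, C. Beetle, J. Lewandowski, Class. Quantum Grav. 19 (2002) 1195–1225, §2.
-/

noncomputable section

open Set Function Module

namespace Literature.Geometry.Lorentzian

section Algebra

variable {V : Type*} [NormedAddCommGroup V] [NormedSpace ℝ V] [FiniteDimensional ℝ V]
  (B : V →L[ℝ] V →L[ℝ] ℝ)

/-- **Null rigidity of a dominated skew/symmetric pair at a null vector.**  Let `B` be a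
Lorentzian scalar product on `V` (a timelike `T`, `B` positive definite on timelike
orthocomplements), `ℓ` a null vector with an orthonormal screen frame `e` (`m + 2 = dim V`), `A` a
`B`-skew endomorphism with `A ℓ = 0`, and `F` an endomorphism with `F ℓ = 0`, `B(F u, ℓ) = 0`,
`B(F u, w) = B(F w, u)` and `tr F = 0`, such that the quadratic form `B(A v, A v)` is dominated by
`B(F v, v)`.  Then `F` kills `ℓ^⊥`, `F = μ B(ℓ, ·) ℓ` with `μ ≥ 0`, and `A = ℓ ∧ β`
(`A v = B(ℓ, v) β - B(β, v) ℓ`) for some `β ⊥ ℓ`.  Proof: `A v ⊥ ℓ`, so `B(A v, A v) ≥ 0`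
(`nonneg_of_orthogonal_null`) and `E(v, w) = B(F v, w)` is positive semidefinite; its screen trace
is `tr F = 0` (`trace_eq_sum_screen_of_null`), so `E` vanishes on the screen frame, hence (Cauchy–
Schwarz for semidefinite forms) `E(eᵢ, ·) = 0`, `F eᵢ = 0`, `F = 0` on `ℓ^⊥ = screen ⊕ ℝℓ`
(`exists_eq_sum_screen_add_smul`); `F T ⊥ ℓ^⊥` forces `F T ∈ ℝℓ`; finally on `ℓ^⊥` the dominated
form `B(A v, A v)` vanishes, so `A v ∈ ℝℓ` there (`exists_smul_of_orthogonal_null`), and pairing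
with `T` identifies `A` with `ℓ ∧ β`, `β = B(T, ℓ)⁻¹ A T`.  (Pointwise algebra of the "evanescent
light point" theorem below; cf. the isolated-horizon constraints `Ψ₀ = Ψ₁ = 0`,
Ashtekar–Beetle–Lewandowski 2002, §2.) [folklore] -/
theorem null_rigidity_of_dominated (hB : ∀ v w : V, B v w = B w v)
    (hpos : ∀ t w : V, B t t < 0 → B t w = 0 → w ≠ 0 → 0 < B w w) {T : V} (hT : B T T < 0)
    {ι : Type*} [Fintype ι] [DecidableEq ι] {e : ι → V}
    (hon : ∀ i j, B (e i) (e j) = if i = j then 1 else 0) {ℓ : V} (hℓ0 : B ℓ ℓ = 0) (hℓ : ℓ ≠ 0)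
    (hℓe : ∀ i, B (e i) ℓ = 0) (hcard : Fintype.card ι + 2 = finrank ℝ V)
    (A : V →ₗ[ℝ] V) (hA : ∀ v w, B (A v) w + B v (A w) = 0) (hAℓ : A ℓ = 0)
    (F : V →ₗ[ℝ] V) (hFℓ : F ℓ = 0) (hFskew : ∀ u, B (F u) ℓ = 0)
    (hFsymm : ∀ u w, B (F u) w = B (F w) u) (htr : LinearMap.trace ℝ V F = 0)
    (hH : ∀ v, B (A v) (A v) ≤ B (F v) v) :
    (∀ v, B v ℓ = 0 → F v = 0) ∧
      (∃ μ : ℝ, 0 ≤ μ ∧ ∀ v, F v = (μ * B ℓ v) • ℓ) ∧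
      ∃ β : V, B β ℓ = 0 ∧ ∀ v, A v = B ℓ v • β - B β v • ℓ := by
  classical
  have hα : B T ℓ ≠ 0 := fun h ↦ by
    have := hpos T ℓ hT h hℓ
    rw [hℓ0] at this
    exact lt_irrefl 0 this
  -- non-degeneracy of `B`
  have hnondeg : ∀ u, (∀ w, B u w = 0) → u = 0 := by
    intro u hu
    by_contra hne
    have := hpos T u hT (by rw [hB]; exact hu T) hne
    rw [hu u] at this
    exact lt_irrefl 0 this
  -- S1: `A v ⊥ ℓ`
  have hAskewℓ : ∀ v, B (A v) ℓ = 0 := fun v ↦ by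
    have := hA v ℓ
    rw [hAℓ, map_zero] at this
    linarith
  -- S2: `B(A v, A v) ≥ 0`, S3: `E ≥ 0`
  have hQnn : ∀ v, 0 ≤ B (A v) (A v) := fun v ↦
    nonneg_of_orthogonal_null B hpos hℓ0 hℓ (hAskewℓ v)
  have hEnn : ∀ v, 0 ≤ B (F v) v := fun v ↦ (hQnn v).trans (hH v)
  -- S4: a row of the semidefinite form `E` with zero diagonal entry vanishes
  have hErow : ∀ v, B (F v) v = 0 → ∀ w, B (F v) w = 0 := by
    intro v hv w
    set a : ℝ := B (F v) w with ha
    set c : ℝ := B (F w) w with hc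
    have hc0 : 0 ≤ c := hEnn w
    have ha' : B (F w) v = a := by rw [ha, hFsymm]
    have key := hEnn (v + (-(a / (c + 1))) • w)
    have hexp : B (F (v + (-(a / (c + 1))) • w)) (v + (-(a / (c + 1))) • w) =
        2 * (-(a / (c + 1))) * a + (-(a / (c + 1))) ^ 2 * c := by
      simp only [map_add, map_smul, add_apply,
        FunLike.coe_smul, Pi.smul_apply, smul_eq_mul, hv, ← ha, ha', ← hc]
      ring
    rw [hexp] at key
    have hc1 : 0 < c + 1 := by linarith
    have h2 : 2 * (-(a / (c + 1))) * a + (-(a / (c + 1))) ^ 2 * c =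
        -(a ^ 2 * (c + 2)) / (c + 1) ^ 2 := by
      field_simp
      ring
    rw [h2] at key
    have h3 : a ^ 2 * (c + 2) ≤ 0 := by
      have h4 : 0 < (c + 1) ^ 2 := by positivity
      have := mul_nonneg key h4.le
      rw [div_mul_cancel₀ _ h4.ne'] at this
      linarith
    have h5 : a ^ 2 = 0 := by nlinarith [sq_nonneg a]
    exact pow_eq_zero_iff (n := 2) (by norm_num) |>.1 h5
  -- S5/S6: the screen trace of `E` is `tr F = 0`, so `E(eᵢ, eᵢ) = 0` and `F eᵢ = 0`
  have htrF := trace_eq_sum_screen_of_null B hB hpos hT hon hℓ0 hℓ hℓe hcard F hFℓ hFskew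
  rw [htr] at htrF
  have hEi : ∀ i, B (F (e i)) (e i) = 0 := by
    have h := (Finset.sum_eq_zero_iff_of_nonneg fun i _ ↦ hEnn (e i)).1 htrF.symm
    exact fun i ↦ h i (Finset.mem_univ i)
  have hFe : ∀ i, F (e i) = 0 := fun i ↦ hnondeg _ (hErow (e i) (hEi i))
  -- S7: `F = 0` on `ℓ^⊥`
  have hFzero : ∀ v, B v ℓ = 0 → F v = 0 := by
    intro v hv
    obtain ⟨c, hc⟩ := exists_eq_sum_screen_add_smul B hB hpos hT hon hℓ0 hℓ hℓe hcard hv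
    rw [hc]
    simp [map_add, map_sum, map_smul, hFe, hFℓ]
  refine ⟨hFzero, ?_, ?_⟩
  · -- S8: `F v = μ B(ℓ, v) ℓ`
    have hperp : ∀ v, B (v - (B ℓ v / B T ℓ) • T) ℓ = 0 := by
      intro v
      simp only [map_sub, map_smul, sub_apply,
        FunLike.coe_smul, Pi.smul_apply, smul_eq_mul]
      rw [hB v ℓ]
      field_simp
      ring
    have hFv : ∀ v, F v = (B ℓ v / B T ℓ) • F T := by
      intro v
      have h0 := hFzero _ (hperp v)
      rwa [map_sub, map_smul, sub_eq_zero] at h0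
    obtain ⟨c₀, hc₀⟩ := exists_eq_sum_screen_add_smul B hB hpos hT hon hℓ0 hℓ hℓe hcard (hFskew T)
    have hFTe : ∀ i, B (F T) (e i) = 0 := fun i ↦ by
      rw [hFsymm, hFe, map_zero, zero_apply]
    simp only [hFTe, zero_smul, Finset.sum_const_zero, zero_add] at hc₀
    refine ⟨c₀ / B T ℓ, ?_, fun v ↦ ?_⟩
    · have h1 : 0 ≤ B (F T) T := hEnn T
      rw [hc₀, map_smul, FunLike.coe_smul, Pi.smul_apply, smul_eq_mul, hB ℓ T] at h1
      have h2 : c₀ / B T ℓ = c₀ * B T ℓ / (B T ℓ * B T ℓ) := by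
        field_simp
      rw [h2]
      exact div_nonneg h1 (mul_self_nonneg _)
    · rw [hFv v, hc₀, smul_smul]
      congr 1
      ring
  · -- S9: `A = ℓ ∧ β`, `β = B(T, ℓ)⁻¹ A T`
    have hAv : ∀ v, B v ℓ = 0 → ∃ c : ℝ, A v = c • ℓ := by
      intro v hv
      have h1 : B (A v) (A v) = 0 := by
        refine le_antisymm ?_ (hQnn v)
        have := hH v
        rwa [hFzero v hv, map_zero, zero_apply] at this
      exact exists_smul_of_orthogonal_null B hB hpos hT hℓ0 hℓ (hAskewℓ v) h1
    set β : V := (B T ℓ)⁻¹ • A T with hβ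
    have hATβ : A T = B T ℓ • β := by
      rw [hβ, smul_smul, mul_inv_cancel₀ hα, one_smul]
    have hβℓ : B β ℓ = 0 := by
      rw [hβ, map_smul, FunLike.coe_smul, Pi.smul_apply, hAskewℓ T, smul_zero]
    -- `B(T, A T) = 0` (skewness), hence `B(T, β) = 0`
    have hTAT : B T (A T) = 0 := by
      have h1 := hA T T
      rw [hB (A T) T] at h1
      linarith
    have hTβ : B T β = 0 := by
      rw [hβ, map_smul, smul_eq_mul, hTAT, mul_zero]
    refine ⟨β, hβℓ, fun v ↦ ?_⟩
    -- decompose `v = v' + (B ℓ v / B T ℓ) T` with `v' ⊥ ℓ`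
    set v' : V := v - (B ℓ v / B T ℓ) • T with hv'
    have hv'ℓ : B v' ℓ = 0 := by
      simp only [hv', map_sub, map_smul, sub_apply,
        FunLike.coe_smul, Pi.smul_apply, smul_eq_mul]
      rw [hB v ℓ]
      field_simp
      ring
    obtain ⟨c, hc⟩ := hAv v' hv'ℓ
    -- pair `A v' = c ℓ` with `T`: `c B(ℓ, T) = B(A v', T) = -B(v', A T) = -B(T, ℓ) B(v', β)`
    have hcT : c * B ℓ T = -(B T ℓ * B v' β) := by
      have h1 := hA v' T
      rw [hc, hATβ, map_smul, FunLike.coe_smul, Pi.smul_apply, smul_eq_mul, map_smul,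
        smul_eq_mul] at h1
      linarith
    have hcv : c = -B v' β := by
      rw [hB ℓ T] at hcT
      have := mul_right_cancel₀ hα (hcT.trans (by ring : -(B T ℓ * B v' β) = -B v' β * B T ℓ))
      exact this
    have hv'β : B v' β = B v β := by
      simp only [hv', map_sub, map_smul, sub_apply,
        FunLike.coe_smul, Pi.smul_apply, smul_eq_mul, hTβ, mul_zero, sub_zero]
    have hvsplit : v = v' + (B ℓ v / B T ℓ) • T := by rw [hv']; abel
    calc A v = A v' + (B ℓ v / B T ℓ) • A T := by
          conv_lhs => rw [hvsplit]
          rw [map_add, map_smul]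
      _ = B ℓ v • β - B β v • ℓ := by
          rw [hc, hcv, hv'β, hATβ, smul_smul, div_mul_cancel₀ _ hα, hB v β, neg_smul]
          abel

/-- **Consequences of `A = ℓ ∧ β`**: `B(A v, A v) = B(ℓ, v)² B(β, β)` and `A (A v) =
-(B(β, β) B(ℓ, v)) ℓ`, so `A ∘ A` is a rank-one map with vanishing trace
(`LinearMap.trace_smulRight`: `tr (φ ⊗ ℓ) = φ(ℓ) = -B(β,β) B(ℓ,ℓ) = 0`). [folklore] -/
theorem trace_comp_self_eq_zero_of_eq_wedge {ℓ β : V} (hℓ0 : B ℓ ℓ = 0) (hβℓ : B β ℓ = 0)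
    (hB : ∀ v w : V, B v w = B w v) (A : V →ₗ[ℝ] V) (hA : ∀ v, A v = B ℓ v • β - B β v • ℓ) :
    (∀ v, B (A v) (A v) = (B ℓ v) ^ 2 * B β β) ∧ LinearMap.trace ℝ V (A ∘ₗ A) = 0 := by
  have hℓβ : B ℓ β = 0 := by rw [hB]; exact hβℓ
  refine ⟨fun v ↦ ?_, ?_⟩
  · rw [hA v]
    simp only [map_sub, map_smul, sub_apply, FunLike.coe_smul,
      Pi.smul_apply, smul_eq_mul, hℓ0, hβℓ, hℓβ]
    ring
  · have hAA : A ∘ₗ A = ((-B β β) • (B ℓ : V →L[ℝ] ℝ).toLinearMap).smulRight ℓ := by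
      ext v
      simp only [LinearMap.coe_comp, Function.comp_apply, LinearMap.smulRight_apply,
        LinearMap.smul_apply, ContinuousLinearMap.coe_coe, smul_eq_mul]
      rw [hA v, map_sub, map_smul, map_smul, hA β, hA ℓ]
      simp only [hℓ0, hβℓ, hℓβ, zero_smul, smul_zero, sub_zero, sub_self, zero_sub, neg_mul,
        neg_smul]
      rw [smul_neg, smul_smul, mul_comm]
    rw [hAA, LinearMap.trace_smulRight]
    simp [hℓ0]

/-- **A skew map killing a null vector and null on the screen is a null bivector.**  With `B`,
`T`, `ℓ`, `e` as above (`NullScreenAlgebra.lean`), let `A` be `B`-skew with `A ℓ = 0` and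
`B(A eᵢ, A eᵢ) = 0` for every screen vector `eᵢ` (equivalently `tr(A ∘ A) = 0`, the screen sum
`-∑ᵢ B(A eᵢ, A eᵢ)` of nonnegative terms).  Then `A = ℓ ∧ β` (`A v = B(ℓ, v) β - B(β, v) ℓ`)
for some `β ⊥ ℓ`: each `A eᵢ ⊥ ℓ` is null, hence in `ℝℓ` (`exists_smul_of_orthogonal_null`), so
`A(ℓ^⊥) ⊆ ℝℓ` (`exists_eq_sum_screen_add_smul`), and pairing with `T` identifies `A` with
`ℓ ∧ β`, `β = B(T, ℓ)⁻¹ A T` — the last step of `null_rigidity_of_dominated`, isolated.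
(Hawking–Ellis 1973, §4.2: the `2`-form `dℓ♭` of a twist-, shear- and expansion-free null
direction.) [folklore] -/
theorem exists_eq_wedge_of_skew_of_screen_sq_eq_zero (hB : ∀ v w : V, B v w = B w v)
    (hpos : ∀ t w : V, B t t < 0 → B t w = 0 → w ≠ 0 → 0 < B w w) {T : V} (hT : B T T < 0)
    {ι : Type*} [Fintype ι] [DecidableEq ι] {e : ι → V}
    (hon : ∀ i j, B (e i) (e j) = if i = j then 1 else 0) {ℓ : V} (hℓ0 : B ℓ ℓ = 0) (hℓ : ℓ ≠ 0)
    (hℓe : ∀ i, B (e i) ℓ = 0) (hcard : Fintype.card ι + 2 = finrank ℝ V)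
    (A : V →ₗ[ℝ] V) (hA : ∀ v w, B (A v) w + B v (A w) = 0) (hAℓ : A ℓ = 0)
    (hAe : ∀ i, B (A (e i)) (A (e i)) = 0) :
    ∃ β : V, B β ℓ = 0 ∧ ∀ v, A v = B ℓ v • β - B β v • ℓ := by
  classical
  have hα : B T ℓ ≠ 0 := fun h ↦ by
    have := hpos T ℓ hT h hℓ
    rw [hℓ0] at this
    exact lt_irrefl 0 this
  -- `A v ⊥ ℓ`
  have hAskewℓ : ∀ v, B (A v) ℓ = 0 := fun v ↦ by
    have := hA v ℓ
    rw [hAℓ, map_zero] at this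
    linarith
  -- each `A eᵢ` is a multiple of `ℓ`, hence so is `A v` for `v ⊥ ℓ`
  have hAei : ∀ i, ∃ c : ℝ, A (e i) = c • ℓ := fun i ↦
    exists_smul_of_orthogonal_null B hB hpos hT hℓ0 hℓ (hAskewℓ (e i)) (hAe i)
  choose c hc using hAei
  have hAv : ∀ v, B v ℓ = 0 → ∃ c : ℝ, A v = c • ℓ := by
    intro v hv
    obtain ⟨c₀, hc₀⟩ := exists_eq_sum_screen_add_smul B hB hpos hT hon hℓ0 hℓ hℓe hcard hv
    refine ⟨∑ i, B v (e i) * c i, ?_⟩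
    have h1 : A v = ∑ i, B v (e i) • A (e i) + c₀ • A ℓ := by
      conv_lhs => rw [hc₀]
      rw [map_add, map_sum, map_smul]
      congr 1
      exact Finset.sum_congr rfl fun i _ ↦ by rw [map_smul]
    rw [h1, hAℓ, smul_zero, add_zero, Finset.sum_smul]
    refine Finset.sum_congr rfl fun i _ ↦ ?_
    rw [hc i, smul_smul]
  -- `β = B(T, ℓ)⁻¹ A T`
  set β : V := (B T ℓ)⁻¹ • A T with hβ
  have hATβ : A T = B T ℓ • β := by
    rw [hβ, smul_smul, mul_inv_cancel₀ hα, one_smul]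
  have hβℓ : B β ℓ = 0 := by
    rw [hβ, map_smul, FunLike.coe_smul, Pi.smul_apply, hAskewℓ T, smul_zero]
  have hTAT : B T (A T) = 0 := by
    have h1 := hA T T
    rw [hB (A T) T] at h1
    linarith
  have hTβ : B T β = 0 := by
    rw [hβ, map_smul, smul_eq_mul, hTAT, mul_zero]
  refine ⟨β, hβℓ, fun v ↦ ?_⟩
  set v' : V := v - (B ℓ v / B T ℓ) • T with hv'
  have hv'ℓ : B v' ℓ = 0 := by
    simp only [hv', map_sub, map_smul, sub_apply,
      FunLike.coe_smul, Pi.smul_apply, smul_eq_mul]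
    rw [hB v ℓ]
    field_simp
    ring
  obtain ⟨c', hc'⟩ := hAv v' hv'ℓ
  have hcT : c' * B ℓ T = -(B T ℓ * B v' β) := by
    have h1 := hA v' T
    rw [hc', hATβ, map_smul, FunLike.coe_smul, Pi.smul_apply, smul_eq_mul, map_smul,
      smul_eq_mul] at h1
    linarith
  have hcv : c' = -B v' β := by
    rw [hB ℓ T] at hcT
    have := mul_right_cancel₀ hα (hcT.trans (by ring : -(B T ℓ * B v' β) = -B v' β * B T ℓ))
    exact this
  have hv'β : B v' β = B v β := by
    simp only [hv', map_sub, map_smul, sub_apply,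
      FunLike.coe_smul, Pi.smul_apply, smul_eq_mul, hTβ, mul_zero, sub_zero]
  have hvsplit : v = v' + (B ℓ v / B T ℓ) • T := by rw [hv']; abel
  calc A v = A v' + (B ℓ v / B T ℓ) • A T := by
        conv_lhs => rw [hvsplit]
        rw [map_add, map_smul]
    _ = B ℓ v • β - B β v • ℓ := by
        rw [hc', hcv, hv'β, hATβ, smul_smul, div_mul_cancel₀ _ hα, hB v β, neg_smul]
        abel

end Algebra

end Literature.Geometry.Lorentzian

end
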